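import Summits.BirchSwinnertonDyer.BirchSwinnertonDyer.Theorems.PrintX9HowardIMCLink
import Summits.BirchSwinnertonDyer.BirchSwinnertonDyer.Theorems.Rank1ResidualX9CMPartner
import HarnessLib

/-!
# Lines `torsion-depth` (crux stmt-BirchSwinnertonDyer-23161 `HowardContainmentAnyClassNumber`) and
# `torsion-depth-light` (crux stmt-BirchSwinnertonDyer-24424 `HowardContainmentLightFrame`), stub s1
# `stub_coprimeClassNumber` — the PRINTED regime `p ∤ h_K` — BY SIGNATURE, for the GIVEN embedding
# `jbar`, modulo the cite-only named fact Mastella–Zerman 2026 Cor. 4.6 (`h46`)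

HONEST FRAMING (cell `run/shared/lean/pub/bsd-print-x9/`, D-0131 print tier; typer seat ty3 serving
planner g7's wake «(typer-sized, by-name) stub s1 of line torsion-depth … a conditional theorem
`h46 → Stmt.stub_coprimeClassNumber`» — hence the file lives in the cell's typer tree
`Rank1Residual/X9/`, not under `BirchSwinnertonDyer/Theorems/` (prover-only, D-0016)): THEOREMS ONLY
(no definition, no named fact, no `sorry`); ROUTE-FREE (no `Theses.*` import); nothing booked,
closed or edited. The two registered stub STATEMENTS (`Stmt.stub_coprimeClassNumber` of
`run/shared/lean/pub/bsd-print-x9/plan/skeletons/23161-torsion-depth/torsion-depth.lean` and of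
`…/24424-torsion-depth-light/torsion-depth-light.lean`, namespaces
`Summit.BirchSwinnertonDyer.BirchSwinnertonDyer.Cruxes.HowardContainmentAnyClassNumber.TorsionDepth` /
`….Cruxes.HowardContainmentLightFrame.TorsionDepthLight`) are NOT re-declared here (the skeletons are
not tree modules; re-declaring their head constants in the typer tree would collide with the line files):
each theorem below concludes the stub's definiens VERBATIM, so in a line file that declares the `Stmt`
def the stub is discharged by one line,
`theorem stub_coprimeClassNumber_of_cor46 (h46 : …) : Stmt.stub_coprimeClassNumber := X9.torsionDepth_stub_coprimeClassNumber_of_cor46 h46`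
(definitional unfolding), resp. `X9.torsionDepthLight_stub_coprimeClassNumber_of_cor46 h46`.
«beyond-print theorem»: NO — s1 is PRINT modulo the cite-only fact `h46`
(`MastellaZerman2026.cor46_howardDivisibility_of_scalarImage`: Howard's Thm. B under (irr) + "the
`p`-adic image contains the scalars `1 + pℤ_p`" + non-CM, any odd `p`, `p ∤ h_K`), whose scalar
hypothesis is a THEOREM on class X9 (Lombardo–Tronto 2022, `ClassX9.hasPadicScalarImage`, ty2 file P).
BSD is not proved by any of this; the cruxes 23161 / 24424 are NOT closed (their open regimes are
`p ∣ h_K`: stubs s2–s4, beyond print — cell DOSSIER §41/§47).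

WHAT. For the GIVEN `jbar : K̄ → ℂ` (the registered stubs quantify `jbar`; the tree's
`X9.heegnerContainment_of_cor46` — Theorems/PrintX9HowardIMCLink.lean §2 — produces its own `jbar` by
`IsAlgClosed.lift` and concludes `∃ jbar …`): the data are PRODUCED exactly as there — `𝔖_p(K_∞)` by
`LambdaAdicSelmerDataExists.nonempty_lambdaAdicSelmerData` (Perrin-Riou 1987 §0), the Heegner family
`ℋ_∞` AT `jbar` by `nonempty_heegnerFamily_of` ∘ `exists_isHeegnerNormPoint_holds` (Howard §2.7/§3.3,
Gross §3, Darmon Thm. 3.6 — PROVED for every `jbar`), the Selmer dual `X` by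
`nonempty_selmerDualData_holds` (Greenberg LNM 1716 §1) — and Mastella–Zerman Cor. 4.6 is applied AT
`jbar` through `MastellaZerman2026.conclusion_of_cor46` with ty2's constructor `ClassX9.mz26Hypotheses`
(the items' class predicate `Summit.….Rank1Residual.ClassX9` converted to the census predicate by
`classX9_census_of_classX9`; on the light line `d_K ≠ -4` follows from `Odd d_K`). The light stub's extra
binders `(irr_K)`, `rank E(K) = 1`, `Ш(E/K)[p^∞]` finite are not used.

References: [MastellaZerman2026] Cor. 4.6, Assumptions 2.1 and 2.13 (v) (arXiv:2505.08710);
[LombardoTronto2022] Thm. 3.16; [Howard2004HeegnerKolyvagin] Thm. B, §2.7, §3.3;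
[PerrinRiou1987BSMF] §0 (p. 402); [GreenbergLNM1716] §1; [BurungaleCastellaKim2021] Thm. 3.1.
-/

set_option linter.dupNamespace false
set_option autoImplicit false

noncomputable section

open scoped Classical

open WeierstrassCurve NumberField Literature.NumberTheory.EllipticCurves
  Literature.NumberTheory.EllipticCurves.ModularForms
  Literature.NumberTheory.EllipticCurves.Rank1Residual
  Literature.NumberTheory.EllipticCurves.YanZhu2026

namespace Summit.BirchSwinnertonDyer.Rank1Residual

namespace X9

/-! ### §1 The containment AT a given `jbar` on an X9 Heegner frame with `p ∤ h_K` (census class predicate) -/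

/-- **Howard's containment `Char(S_ord/Λκ)² ⊆ Char(𝒳_ord,tor)` HOLDS, for a GIVEN complex embedding
`jbar : K̄ → ℂ`, on an X9 pair over a Heegner field with `p` split, `d_K ∉ {−3, −4}` and `p ∤ h_K`, for
every anticyclotomic datum `(κ, γ)`** — the `jbar`-pointed twin of `X9.heegnerContainment_of_cor46`:
data `D`, `ℋ_∞` (at `jbar`), `X` produced by the tree's existence theorems, Mastella–Zerman 2026 Cor. 4.6
(`h46`) applied at `jbar` via `MastellaZerman2026.conclusion_of_cor46` and `ClassX9.mz26Hypotheses`.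
[cite: MastellaZerman2026, Cor. 4.6, Assumptions 2.1 and 2.13 (v) (arXiv:2505.08710)]
[cite: LombardoTronto2022, Thm. 3.16] [cite: Howard2004HeegnerKolyvagin, Thm. B, §2.7, §3.3]
[cite: PerrinRiou1987BSMF, §0 (p. 402)] [cite: GreenbergLNM1716, §1] -/
theorem heegnerContainmentAt_of_cor46
    (h46 : MastellaZerman2026.cor46_howardDivisibility_of_scalarImage.{0})
    {W : WeierstrassCurve ℚ} [W.IsElliptic] [W.IsGloballyMinimal] {p : ℕ} [Fact p.Prime]
    [NeZero (W.conductorNorm ℤ)] {K : Type} [Field K] [NumberField K]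
    (hX9 : Literature.NumberTheory.EllipticCurves.Rank1Residual.ClassX9 W p)
    (hK : IsImaginaryQuadratic K) (h3 : NumberField.discr K ≠ -3) (h4 : NumberField.discr K ≠ -4)
    (hHN : SatisfiesHeegnerHypothesis (W.conductorNorm ℤ) K) (hHp : SatisfiesHeegnerHypothesis p K)
    (hhK : ¬ p ∣ NumberField.classNumber K)
    (κ : ZpExtension K p) (hκ : κ.IsAnticyclotomic)
    (γ : Field.absoluteGaloisGroup K) (hγ : κ.IsTopGenerator γ)
    (Dt : ModularParametrizationData W (W.conductorNorm ℤ))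
    (H : HeegnerDatum (W.conductorNorm ℤ) (NumberField.discr K))
    (jbar : AlgebraicClosure K →+* ℂ) :
    ∃ (D : (W.baseChange K).LambdaAdicSelmerData κ γ)
      (F : HeegnerFamily (W.conductorNorm ℤ) W K κ jbar) (X : (W.baseChange K).SelmerDualData κ γ),
      heegnerCharIdeal D F ^ 2 ≤
        Module.charIdeal (IwasawaAlgebra p) (Submodule.torsion (IwasawaAlgebra p) X.X) := by
  -- the data exist, the Heegner family AT the given `jbar`
  obtain ⟨D⟩ := LambdaAdicSelmerDataExists.nonempty_lambdaAdicSelmerData (W.baseChange K) p κ hγ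
  obtain ⟨X⟩ := (W.baseChange K).nonempty_selmerDualData_holds κ γ hγ
  obtain ⟨F⟩ := nonempty_heegnerFamily_of (exists_isHeegnerNormPoint_holds (W.conductorNorm ℤ) W K p)
    hK hHN hX9.not_dvd_conductorNorm κ Dt H.dvd_sq_sub jbar
  -- Mastella–Zerman Cor. 4.6 at the frame, AT `jbar`
  exact ⟨D, F, X, Ideal.le_of_dvd (MastellaZerman2026.conclusion_of_cor46 (jbar := jbar) h46
    (hX9.mz26Hypotheses κ γ hK ⟨h3, h4⟩ hHN hHp hhK hκ hγ) D F X)⟩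

/-! ### §2 Stub s1 of line `torsion-depth` (crux 23161), BY SIGNATURE, modulo `h46` -/

/-- **Stub `stub_coprimeClassNumber` of line `torsion-depth` on crux `HowardContainmentAnyClassNumber`
(stmt-BirchSwinnertonDyer-23161) — the printed regime `p ∤ h_K` — modulo the cite-only fact `h46`
(Mastella–Zerman 2026 Cor. 4.6).** The conclusion is the definiens of the registered
`Cruxes.HowardContainmentAnyClassNumber.TorsionDepth.Stmt.stub_coprimeClassNumber` VERBATIM
(skeleton `plan/skeletons/23161-torsion-depth/torsion-depth.lean`): on an X9 Heegner frame
(`ClassX9 W p` in the items' letter, `K` imaginary quadratic, `d_K ≠ -3, -4`, Heegner for `N_E` and for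
`p`, anticyclotomic `(κ, γ)` with a topological generator, data `Dt`, `H`, `ιC`) and for the GIVEN
`jbar`, if `p ∤ h_K` then `I(ℋ_∞)² ⊆ char_Λ(X_tors)` for some `(D, ℋ_∞, X)` at `jbar`. PRINT modulo
`h46`; «beyond-print theorem»: no. [cite: MastellaZerman2026, Cor. 4.6 (arXiv:2505.08710)]
[cite: BurungaleCastellaKim2021, Thm. 3.1] -/
theorem torsionDepth_stub_coprimeClassNumber_of_cor46
    (h46 : MastellaZerman2026.cor46_howardDivisibility_of_scalarImage.{0}) :
    ∀ (W : WeierstrassCurve ℚ) [W.IsElliptic] [W.IsGloballyMinimal] (p : ℕ) [Fact p.Prime]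
      [NeZero (W.conductorNorm ℤ)] (K : Type) [Field K] [NumberField K],
      Summit.BirchSwinnertonDyer.BirchSwinnertonDyer.Rank1Residual.ClassX9 W p →
      IsImaginaryQuadratic K → NumberField.discr K ≠ -3 → NumberField.discr K ≠ -4 →
      SatisfiesHeegnerHypothesis (W.conductorNorm ℤ) K → SatisfiesHeegnerHypothesis p K →
      ∀ (κ : ZpExtension K p), κ.IsAnticyclotomic → ∀ (γ : Field.absoluteGaloisGroup K),
      κ.IsTopGenerator γ →
      ∀ (Dt : ModularForms.ModularParametrizationData W (W.conductorNorm ℤ))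
        (H : HeegnerDatum (W.conductorNorm ℤ) (NumberField.discr K)) (ιC : K →+* ℂ)
        (jbar : AlgebraicClosure K →+* ℂ),
      ¬ p ∣ NumberField.classNumber K →
      ∃ (D : (W.baseChange K).LambdaAdicSelmerData κ γ)
        (F : HeegnerFamily (W.conductorNorm ℤ) W K κ jbar) (X : (W.baseChange K).SelmerDualData κ γ),
        heegnerCharIdeal D F ^ 2 ≤
          Module.charIdeal (IwasawaAlgebra p) (Submodule.torsion (IwasawaAlgebra p) X.X) := by
  intro W _ _ p _ _ K _ _ hX9 hK h3 h4 hHN hHp κ hκ γ hγ Dt H _ jbar hhK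
  exact heegnerContainmentAt_of_cor46 h46
    (Summit.BirchSwinnertonDyer.BirchSwinnertonDyer.Rank1Residual.classX9_census_of_classX9 W p hX9)
    hK h3 h4 hHN hHp hhK κ hκ γ hγ Dt H jbar

/-! ### §3 Stub s1 of line `torsion-depth-light` (crux 24424), BY SIGNATURE, modulo `h46` -/

/-- **Stub `stub_coprimeClassNumber` of line `torsion-depth-light` on crux `HowardContainmentLightFrame`
(stmt-BirchSwinnertonDyer-24424) — the printed regime `p ∤ h_K` on the rank-one LIGHT frames — modulo
the cite-only fact `h46` (Mastella–Zerman 2026 Cor. 4.6).** The conclusion is the definiens of the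
registered `Cruxes.HowardContainmentLightFrame.TorsionDepthLight.Stmt.stub_coprimeClassNumber` VERBATIM
(skeleton `plan/skeletons/24424-torsion-depth-light/torsion-depth-light.lean`): as in §2 with the light
binders `Odd d_K` (whence `d_K ≠ -4`), `(irr_K)`, `rank E(K) = 1`, `Ш(E/K)[p^∞]` finite (the last three
unused). PRINT modulo `h46`; «beyond-print theorem»: no.
[cite: MastellaZerman2026, Cor. 4.6 (arXiv:2505.08710)] [cite: BurungaleCastellaKim2021, Thm. 3.1] -/
theorem torsionDepthLight_stub_coprimeClassNumber_of_cor46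
    (h46 : MastellaZerman2026.cor46_howardDivisibility_of_scalarImage.{0}) :
    ∀ (W : WeierstrassCurve ℚ) [W.IsElliptic] [W.IsGloballyMinimal] (p : ℕ) [Fact p.Prime]
      [NeZero (W.conductorNorm ℤ)] (K : Type) [Field K] [NumberField K],
      Summit.BirchSwinnertonDyer.BirchSwinnertonDyer.Rank1Residual.ClassX9 W p →
      IsImaginaryQuadratic K → Odd (NumberField.discr K) → NumberField.discr K ≠ -3 →
      SatisfiesHeegnerHypothesis (W.conductorNorm ℤ) K → SatisfiesHeegnerHypothesis p K →
      (W.baseChange K).HasIrreducibleModPGaloisRep p →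
      ∀ (κ : ZpExtension K p), κ.IsAnticyclotomic → ∀ (γ : Field.absoluteGaloisGroup K),
      κ.IsTopGenerator γ →
      ∀ (Dt : ModularForms.ModularParametrizationData W (W.conductorNorm ℤ))
        (H : HeegnerDatum (W.conductorNorm ℤ) (NumberField.discr K)) (ιC : K →+* ℂ)
        (jbar : AlgebraicClosure K →+* ℂ),
      (W.baseChange K).mordellWeilRank = 1 →
      Finite (AddCommGroup.primaryComponent (W.baseChange K).sha p) →
      ¬ p ∣ NumberField.classNumber K →
      ∃ (D : (W.baseChange K).LambdaAdicSelmerData κ γ)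
        (F : HeegnerFamily (W.conductorNorm ℤ) W K κ jbar) (X : (W.baseChange K).SelmerDualData κ γ),
        heegnerCharIdeal D F ^ 2 ≤
          Module.charIdeal (IwasawaAlgebra p) (Submodule.torsion (IwasawaAlgebra p) X.X) := by
  intro W _ _ p _ _ K _ _ hX9 hK hodd h3 hHN hHp _ κ hκ γ hγ Dt H _ jbar _ _ hhK
  have h4 : NumberField.discr K ≠ -4 := fun h ↦ by
    rw [h] at hodd; exact (Int.not_odd_iff_even.mpr ⟨-2, by norm_num⟩) hodd
  exact heegnerContainmentAt_of_cor46 h46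
    (Summit.BirchSwinnertonDyer.BirchSwinnertonDyer.Rank1Residual.classX9_census_of_classX9 W p hX9)
    hK h3 h4 hHN hHp hhK κ hκ γ hγ Dt H jbar

end X9

end Summit.BirchSwinnertonDyer.Rank1Residual

end
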